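import Literature.NumberTheory.EllipticCurves.LeadingTermBSZRankOneLegProofs
import Literature.NumberTheory.EllipticCurves.LeadingTermBSZRankOneMultiplicativeLegProofs
import Literature.NumberTheory.EllipticCurves.SkinnerZhang2014.MultiplicativePConverse
import HarnessLib

/-!
# Bhargava–Skinner–Zhang, Theorem 9 on BOTH legs of hypothesis (a), and the binder `h9` of
# `bsz_rankLeOne_cRank_of_pieces` on ALL of `T ∩ S₁ ∩ W ⊆ S₀(5) = {5 ∤ A}` — the two-leg combinators

Sibling *proofs* file (theorems only: no definition, no named fact, no instance; D-0014 / D-0026)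
of `Literature.NumberTheory.EllipticCurves.LeadingTerm` for the rank part of BSD by naive height;
the rank-`0` analogue (two-leg combinators of Theorem 5, binder `h5`) is the row
`b2b-bsdres-additive-p1`'s `LeadingTermBSZRankZeroH5Proofs`. This file only COMBINES the two legs
of Theorem 9 already in the tree:

* the GOOD-ORDINARY leg (`LeadingTermBSZRankOneLegProofs`: `bsz_thm9_goodOrdinary_of_zhang`,
  `…_of_smul_eq`, `bsz_h9_goodOrdinary_five_of_zhang_of_smul_eq` — below
  `hZ = WZhang2014.thm14i_rank_one_of_selmerCorank_eq_one`, W. Zhang, Camb. J. Math. 2 (2014)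
  Thm. 1.4 (i) AS PRINTED (PUB; cell registry A322), and the Cassels–Tate pairing `hCT`);
* the MULTIPLICATIVE leg (`LeadingTermBSZRankOneMultiplicativeLegProofs`:
  `bsz_thm9_multiplicative_of_skinnerZhang`, `…_of_smul_eq`,
  `bsz_h9_multiplicative_five_of_skinnerZhang(_of_ram)` — below the explicitly labelled OPEN
  hypothesis `hSZ` = Skinner–Zhang arXiv:1407.1099v1 Thm. 1.1, an UNREFEREED PREPRINT (registry
  A326, tier PRE), and `hCT`),

into the statement of

> M. Bhargava, C. Skinner, W. Zhang, *A majority of elliptic curves over `ℚ` satisfy the Birch and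
> Swinnerton-Dyer conjecture*, arXiv:1407.1826v2 (2014), **Theorem 9** (§2.2, p. 5; held text
> `paper:arxiv-1407.1826` p0005 L54–L74): "Let `p ≥ 5` be a prime. Let `E` be an elliptic curve over
> `ℚ` with conductor `N` such that: (a) `E` has good ordinary or multiplicative reduction at `p`;
> (b) `E[p]` is an irreducible `Gal(ℚ̄/ℚ)`-module; (c) for all primes `ℓ ∣∣ N` such that
> `ℓ ≡ ±1 (mod p)`, `E[p]` is ramified at `ℓ`; (d) if `N` is not squarefree, then there exist at
> least two prime factors `ℓ ∣∣ N` with `ℓ ≠ p` and where `E[p]` is ramified; (e) if `E` has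
> multiplicative reduction at `p` then `E[p]` is not finite at `p`, and if `E` has split
> multiplicative reduction at `p` then the `p`-adic Mazur–Tate–Teitelbaum `𝓛`-invariant `𝓛(E)` of
> `E` satisfies `ord_p(𝓛(E)) = 1`; (f) the `p`-Selmer group `S_p(E)` of `E` has order `p`. Then
> the rank and analytic rank of `E` are both equal to `1`." Proof (ibid.): "… It follows from this
> observation and [Z] (for the case of good reduction) and [SZ] (for the case of multiplicative
> reduction) …",

with (a) as the printed DISJUNCTION, and into the ANONYMOUS binder
`h9 : ∀ AB, IsInHeightFamily AB → T AB → S₁ AB → W AB → Nat.card ((shortWeierstrass AB).selmerGroup 5) = 5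
→ rank = 1 ∧ analytic rank = 1` of the theorem of record `bsz_rankLeOne_cRank_of_pieces`
(`LeadingTermBSZResCellAssemblyProofs`) on ALL of `T ⊆ S₀(5) = {5 ∤ A}` (Lemma 17: good ordinary OR
multiplicative at `5`), with the printed bullets of `S₁'(5)`, `S₁(5)` (§3.1, p. 8) and the two
100 % conditions of **Lemma 20** (p. 10, p0010 L21–L25: "`E[p]` is an irreducible
`Gal(ℚ̄/ℚ)`-module; there exist at least two prime factors `ℓ ∣∣ N(E)`, `ℓ ≠ p`, such that `E[p]`
is ramified at `ℓ`" — the latter UNCONDITIONALLY, which implies printed (d) and, together with `p`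
itself under (e), Skinner–Zhang's (e)) as hypotheses in the `(A, B)` currency.

AS-USED vs AS-PRINTED (said once, here, and on every declaration): the good-ordinary leg is applied
through W. Zhang's Thm. 1.4 (i), whose hypothesis (1) is `ρ̄_{E,p}` SURJECTIVE — stronger than
printed (b); the theorems below therefore take (b) in the form `HasSurjectiveModNGaloisRep`
(irreducibility, needed on the multiplicative leg and for `E(ℚ)[p] = 0`, follows: tree
`hasIrreducibleModPGaloisRep_of_hasSurjectiveModNGaloisRep`); (c) is taken in Skinner–Zhang's
spelling `ℓ ≡ ±1 (mod p)` = `(ℓ : ZMod p) = ±1` and converted to Zhang's `p ∣ ℓ - 1 ∨ p ∣ ℓ + 1`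
inside (`zhang_hyp2_of_congr`); (d) is taken in Lemma 20's unconditional form (two multiplicative
`ℓ₁ ≠ ℓ₂`, both `≠ p`, with `p ∤ ord_{ℓ_i}(Δ_min)` — Remark 7: "`E[p]` ramified at `ℓ ∣∣ N`,
`ℓ ≠ p`" `⟺ p ∤ ord_ℓ(Δ_ℓ)`), which gives Zhang's (3) with a vacuous parity clause
(`zhang_hyp3_of_two_ramified`) and Skinner–Zhang's (e) (pair `{p, ℓ₁}`); (e)'s `𝓛`-clause is
converted to Skinner–Zhang's `log_p q_E ∈ pℤ_p^×` by BSZ Lemma 18 (sibling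
`valuation_lInvariant_eq_valuation_padicLog_of_not_dvd`).

Contents:
* `bsz_thm9_multiplicative_of_thm1_1_OPEN` (+ `_of_smul_eq`),
  `bsz_h9_multiplicative_five_of_thm1_1_OPEN` (+ `_of_ram`) — the sibling's multiplicative-leg
  theorems with the OPEN hypothesis taken BY NAME,
  `hSZ : SkinnerZhang2014.thm1_1_rank_one_of_selmerCorank_eq_one_OPEN` (δ-unfolding onto the
  sibling's displayed binder, whose type is that definition's body verbatim);
* `zhang_hyp2_of_congr`, `zhang_hyp3_of_two_ramified` — printed (c) / Lemma 20 ⟹ Zhang's (2) / (3);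
  `not_dvd_padicValInt_minimalDiscriminantInt_of_congr_five` — the `S₁(5)`-bullet transported to a
  global minimal model: every multiplicative `ℓ ≡ ±1 (mod 5)` of `W` has `5 ∤ ord_ℓ(Δ_min)` (Rem. 7,
  held text `paper:arxiv-1407.1826` p0005 L33–L36; the input of `zhang_hyp2_of_congr` at `p = 5`).
  (ERRATUM E-G123-9, docstring-only: this public theorem was missing from the list.)
* `bsz_thm9_of_zhang_of_skinnerZhang` (+ `_of_smul_eq`) — **Theorem 9 on BOTH legs of (a)**,
  `p ≥ 5`, on a global minimal model (resp. any model), below `hZ` (PUB), `hSZ` (OPEN, labelled)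
  and `hCT`;
* `bsz_h9_five_of_zhang_of_skinnerZhang_of_ram`, `bsz_h9_five_of_zhang_of_skinnerZhang` — **the
  binder `h9` on ALL of `T ∩ S₁ ∩ W`** in the `(A, B)` currency (`by_cases 5 ∣ 4A³ + 27B²`:
  multiplicative at `5` ↦ [SZ] leg, good ordinary at `5` ↦ [Z] leg), the two ramified primes read
  on the minimal model (`ℓ ∈ {2, 3}` allowed) resp. in Remark 7's form (`ℓ > 5`,
  `5 ∤ ord_ℓ(4A³ + 27B²)`).

**Every theorem here that mentions `hSZ` is CONDITIONAL on an unrefereed claim («literal-PRE») on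
its multiplicative half;** the good-ordinary half rests on PUBLISHED inputs only. What is NOT done
here: the sets `T`, `S₁`, `W` themselves (item C0, `BSZPieces.lean`); any claim that [SZ] is
proved; the sprint's fork (q3) (carry «literal-PRE» labelled / re-price / drop) is the lead's.
BSD-DENSITY SPRINT (cell `b2b-bsdres`, book `cells/density/CONVERSION-QUEUE.md` §2 Q2): by-name
consumer = the D2 glue `bsz_rankLeOne_cRank_of_facts` (seat `b2b-bsdres-dens-p1`), which now only
has to choose `T`, `S₁`, `W` (pub-bsdpct's set names, C0) and specialise one of the `h9` theorems
here; written as D2-interim by the X2 row (`b2b-bsdres-eisenstein-p2`). HONEST FRAMING: kernel glue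
below NAMED inputs, one of them an OPEN preprint claim; nothing is booked; no density number,
RESIDUAL-MAP mark, tier or status word moves by this file; this is not "finishing BSD".

## References

* [BhargavaSkinnerZhang2014] M. Bhargava, C. Skinner, W. Zhang, arXiv:1407.1826v2, Thm. 9 and its
  proof (§2.2, p. 5); Thm. 5 (c), Rem. 7, Rem. 11 (§2.1, p. 5); §3.1 (p. 8); Lemma 18 (pp. 8–9);
  Lemma 20 (p. 10).
* [WZhang2014] W. Zhang, *Selmer groups and the indivisibility of Heegner points*, Camb. J. Math.
  2 (2014), 191–253, Thm. 1.4 (i) (p. 197).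
* [SkinnerZhang2014] C. Skinner, W. Zhang, arXiv:1407.1099v1 (2014), Thm. 1.1 (p. 1) — PREPRINT.
* [SilvermanAEC2009] J. H. Silverman, *The Arithmetic of Elliptic Curves*, 2nd ed., GTM 106
  (2009), Thm. X.4.14 (Cassels–Tate), X.§4, VII.5, VIII.8 Cor. 8.3.
-/

set_option autoImplicit false

noncomputable section

open scoped Classical
open scoped AddSubgroup

open WeierstrassCurve

namespace Literature.NumberTheory.EllipticCurves

/-! ### The multiplicative leg with the OPEN hypothesis taken BY NAME -/

section ByName

/-- **BSZ Thm 9, MULTIPLICATIVE LEG, in Skinner–Zhang's currency — CONDITIONAL on the unrefereed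
claim `hSZ`, taken BY NAME** (`SkinnerZhang2014.thm1_1_rank_one_of_selmerCorank_eq_one_OPEN`,
registry A326, PRE): the sibling `bsz_thm9_multiplicative_of_skinnerZhang`, whose displayed binder
has that definition's body as its type, instantiated by `hSZ` itself. Global minimal `W`, `p ≥ 5`,
Skinner–Zhang's (a)–(e), `#Sel^(p)(E/ℚ) = p` ⟹ `rank E(ℚ) = 1 ∧ ord_{s=1} L(E,s) = 1`.
A result using this theorem is conditional on an unrefereed claim («literal-PRE»).
[cite: BhargavaSkinnerZhang2014, Thm. 9 and its proof (§2.2, p. 5)]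
[claim: SkinnerZhang2014, status: under-review] -/
theorem bsz_thm9_multiplicative_of_thm1_1_OPEN
    (hSZ : SkinnerZhang2014.thm1_1_rank_one_of_selmerCorank_eq_one_OPEN)
    (hCT : exists_casselsTate_pairing (K := ℚ))
    (W : WeierstrassCurve ℚ) [W.IsElliptic] [W.IsGloballyMinimal] (p : ℕ) [Fact p.Prime]
    (hp : 5 ≤ p) (hH : SkinnerZhang2014.Hypotheses W p)
    (hSel : Nat.card (W.selmerGroup p) = p) :
    W.mordellWeilRank = 1 ∧ W.analyticRank = 1 :=
  bsz_thm9_multiplicative_of_skinnerZhang hSZ hCT W p hp hH hSel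

/-- **BSZ Thm 9, multiplicative leg, ARBITRARY model — CONDITIONAL on `hSZ` (BY NAME).** `E/ℚ`
with global minimal model `W`, `C • W = E`; `p ≥ 5`; Skinner–Zhang's (a)–(e) on `W`; (f) on `E`.
Sibling `bsz_thm9_multiplicative_of_skinnerZhang_of_smul_eq` instantiated by `hSZ`.
[cite: BhargavaSkinnerZhang2014, Thm. 9 (§2.2, p. 5)] [claim: SkinnerZhang2014, status: under-review] -/
theorem bsz_thm9_multiplicative_of_thm1_1_OPEN_of_smul_eq
    (hSZ : SkinnerZhang2014.thm1_1_rank_one_of_selmerCorank_eq_one_OPEN)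
    (hCT : exists_casselsTate_pairing (K := ℚ))
    {W : WeierstrassCurve ℚ} [W.IsElliptic] [W.IsGloballyMinimal] {C : VariableChange ℚ}
    {E : WeierstrassCurve ℚ} [E.IsElliptic] (hCW : C • W = E) (p : ℕ) [Fact p.Prime]
    (hp : 5 ≤ p) (hH : SkinnerZhang2014.Hypotheses W p)
    (hSel : Nat.card (E.selmerGroup p) = p) :
    E.mordellWeilRank = 1 ∧ E.analyticRank = 1 :=
  bsz_thm9_multiplicative_of_skinnerZhang_of_smul_eq hSZ hCT hCW p hp hH hSel

/-- **The binder `h9` on the MULTIPLICATIVE part of `T`, (ram) read on the minimal model —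
CONDITIONAL on `hSZ` (BY NAME).** Sibling `bsz_h9_multiplicative_five_of_skinnerZhang_of_ram`
instantiated by `hSZ : SkinnerZhang2014.thm1_1_rank_one_of_selmerCorank_eq_one_OPEN`; hypotheses
= the printed bullets of `S₀(5)`, `S₁'(5)`, `S₁(5)` in `(A, B)` currency, (irr) on `E_{A,B}`, one
multiplicative `ℓ ≠ 5` of `W` with `5 ∤ ord_ℓ(Δ_min)`, `#Sel^(5)(E_{A,B}/ℚ) = 5`.
[cite: BhargavaSkinnerZhang2014, Thm. 9 (§2.2, p. 5), Thm. 5 (c) and Rem. 7 (§2.1, p. 5), §3.1 (p. 8)]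
[claim: SkinnerZhang2014, status: under-review] -/
theorem bsz_h9_multiplicative_five_of_thm1_1_OPEN_of_ram
    (hSZ : SkinnerZhang2014.thm1_1_rank_one_of_selmerCorank_eq_one_OPEN)
    (hCT : exists_casselsTate_pairing (K := ℚ)) [Fact (Nat.Prime 5)]
    {W : WeierstrassCurve ℚ} [W.IsElliptic] [W.IsGloballyMinimal] {C : VariableChange ℚ}
    {AB : ℤ × ℤ} (hfam : IsInHeightFamily AB) (hCW : C • W = shortWeierstrass AB)
    (hA : ¬ (5 : ℤ) ∣ AB.1) (hD : (5 : ℤ) ∣ 4 * AB.1 ^ 3 + 27 * AB.2 ^ 2)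
    (hfin : ¬ 5 ∣ padicValInt 5 (4 * AB.1 ^ 3 + 27 * AB.2 ^ 2))
    (hL : ∀ [(shortWeierstrass AB).IsElliptic],
      (shortWeierstrass AB).HasSplitMultiplicativeReductionAtPrime 5 →
        ∀ D : TateParameterData (shortWeierstrass AB) 5, (LInvariant D).valuation = 1)
    (hirr : (shortWeierstrass AB).HasIrreducibleModPGaloisRep 5)
    (hc : ∀ (ℓ : ℕ) [Fact ℓ.Prime], ((ℓ : ZMod 5) = 1 ∨ (ℓ : ZMod 5) = -1) →
      0 < padicValInt ℓ (4 * AB.1 ^ 3 + 27 * AB.2 ^ 2) →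
        ¬ 5 ∣ padicValInt ℓ (4 * AB.1 ^ 3 + 27 * AB.2 ^ 2))
    (hram : ∃ ℓ : ℕ, ∃ _ : Fact ℓ.Prime, ℓ ≠ 5 ∧ W.HasMultiplicativeReductionAtPrime ℓ ∧
      ¬ 5 ∣ padicValInt ℓ W.minimalDiscriminantInt)
    (hSel : Nat.card ((shortWeierstrass AB).selmerGroup 5) = 5) :
    (shortWeierstrass AB).mordellWeilRank = 1 ∧ (shortWeierstrass AB).analyticRank = 1 :=
  bsz_h9_multiplicative_five_of_skinnerZhang_of_ram hSZ hCT hfam hCW hA hD hfin hL hirr hc hram hSel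

/-- **The binder `h9` on the MULTIPLICATIVE part of `T` in the `(A, B)` currency — CONDITIONAL on
`hSZ` (BY NAME).** Sibling `bsz_h9_multiplicative_five_of_skinnerZhang` instantiated by
`hSZ : SkinnerZhang2014.thm1_1_rank_one_of_selmerCorank_eq_one_OPEN`; the ramified multiplicative
prime in Remark 7's form (`ℓ > 5`, `5 ∤ ord_ℓ(4A³ + 27B²)`).
[cite: BhargavaSkinnerZhang2014, Thm. 9 (§2.2, p. 5), Rem. 7 (§2.1, p. 5), §3.1 (p. 8)]
[claim: SkinnerZhang2014, status: under-review] -/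
theorem bsz_h9_multiplicative_five_of_thm1_1_OPEN
    (hSZ : SkinnerZhang2014.thm1_1_rank_one_of_selmerCorank_eq_one_OPEN)
    (hCT : exists_casselsTate_pairing (K := ℚ)) [Fact (Nat.Prime 5)]
    {W : WeierstrassCurve ℚ} [W.IsElliptic] [W.IsGloballyMinimal] {C : VariableChange ℚ}
    {AB : ℤ × ℤ} (hfam : IsInHeightFamily AB) (hCW : C • W = shortWeierstrass AB)
    (hA : ¬ (5 : ℤ) ∣ AB.1) (hD : (5 : ℤ) ∣ 4 * AB.1 ^ 3 + 27 * AB.2 ^ 2)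
    (hfin : ¬ 5 ∣ padicValInt 5 (4 * AB.1 ^ 3 + 27 * AB.2 ^ 2))
    (hL : ∀ [(shortWeierstrass AB).IsElliptic],
      (shortWeierstrass AB).HasSplitMultiplicativeReductionAtPrime 5 →
        ∀ D : TateParameterData (shortWeierstrass AB) 5, (LInvariant D).valuation = 1)
    (hirr : (shortWeierstrass AB).HasIrreducibleModPGaloisRep 5)
    (hc : ∀ (ℓ : ℕ) [Fact ℓ.Prime], ((ℓ : ZMod 5) = 1 ∨ (ℓ : ZMod 5) = -1) →
      0 < padicValInt ℓ (4 * AB.1 ^ 3 + 27 * AB.2 ^ 2) →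
        ¬ 5 ∣ padicValInt ℓ (4 * AB.1 ^ 3 + 27 * AB.2 ^ 2))
    (hram : ∃ ℓ : ℕ, ∃ _ : Fact ℓ.Prime, 5 < ℓ ∧
      (shortWeierstrass AB).HasMultiplicativeReductionAtPrime ℓ ∧
        ¬ 5 ∣ padicValInt ℓ (4 * AB.1 ^ 3 + 27 * AB.2 ^ 2))
    (hSel : Nat.card ((shortWeierstrass AB).selmerGroup 5) = 5) :
    (shortWeierstrass AB).mordellWeilRank = 1 ∧ (shortWeierstrass AB).analyticRank = 1 :=
  bsz_h9_multiplicative_five_of_skinnerZhang hSZ hCT hfam hCW hA hD hfin hL hirr hc hram hSel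

end ByName

/-! ### Printed (c) and Lemma 20 ⟹ W. Zhang's hypotheses (2) and (3) -/

section ZhangHypotheses

/-- `p ∣ ℓ - 1 ∨ p ∣ ℓ + 1` (W. Zhang's spelling of `ℓ ≡ ±1 (mod p)`) gives `(ℓ : ZMod p) = ±1`
(Skinner–Zhang's spelling), for `ℓ ≥ 1`. [folklore] -/
private theorem natCast_eq_one_or_eq_neg_one_of_dvd {p ℓ : ℕ} (hℓ : 1 ≤ ℓ)
    (h : p ∣ ℓ - 1 ∨ p ∣ ℓ + 1) : (ℓ : ZMod p) = 1 ∨ (ℓ : ZMod p) = -1 := by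
  rcases h with h | h
  · left
    have h1 : 1 ≡ ℓ [MOD p] := (Nat.modEq_iff_dvd' hℓ).2 h
    have h2 : ((1 : ℕ) : ZMod p) = (ℓ : ZMod p) := (ZMod.natCast_eq_natCast_iff 1 ℓ p).2 h1
    rw [Nat.cast_one] at h2
    exact h2.symm
  · right
    have h1 : ((ℓ + 1 : ℕ) : ZMod p) = 0 := (ZMod.natCast_eq_zero_iff (ℓ + 1) p).2 h
    rw [Nat.cast_add, Nat.cast_one] at h1
    exact eq_neg_of_add_eq_zero_left h1

/-- A set with two distinct members does not have exactly one element (`Set.ncard`; for an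
infinite set `ncard = 0`). [folklore] -/
private theorem setOf_ncard_ne_one {α : Type*} {P : α → Prop} {a b : α} (ha : P a) (hb : P b)
    (hab : a ≠ b) : {x | P x}.ncard ≠ 1 := by
  intro h1
  obtain ⟨c, hc⟩ := Set.ncard_eq_one.1 h1
  have ha' : a = c := Set.mem_singleton_iff.1 ((Set.ext_iff.1 hc a).1 ha)
  have hb' : b = c := Set.mem_singleton_iff.1 ((Set.ext_iff.1 hc b).1 hb)
  exact hab (ha'.trans hb'.symm)

/-- **Printed (c) ⟹ W. Zhang's hypothesis (2).** BSZ Thm 9 (c) ("for all primes `ℓ ∣∣ N` such that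
`ℓ ≡ ±1 (mod p)`, `E[p]` is ramified at `ℓ`"; Remark 7: for `ℓ ≠ p` this is `p ∤ ord_ℓ(Δ_ℓ)`), in
Skinner–Zhang's spelling `(ℓ : ZMod p) = ±1` on a global minimal model, gives Zhang's Thm 1.4
hypothesis (2) in the tree's spelling `p ∣ ℓ - 1 ∨ p ∣ ℓ + 1` (`WZhang2014.thm14i_rank_one_of_selmerCorank_eq_one`).
[cite: BhargavaSkinnerZhang2014, Thm. 9 (c) and Rem. 7 (§2.1–2.2, p. 5)] [cite: WZhang2014, Thm. 1.4 (i) (p. 197), hypothesis (2)] -/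
theorem zhang_hyp2_of_congr (W : WeierstrassCurve ℚ) [W.IsElliptic] [W.IsGloballyMinimal]
    (p : ℕ) [Fact p.Prime]
    (hc : ∀ (ℓ : ℕ) [Fact ℓ.Prime], W.HasMultiplicativeReductionAtPrime ℓ →
      ((ℓ : ZMod p) = 1 ∨ (ℓ : ZMod p) = -1) → ¬ p ∣ padicValInt ℓ W.minimalDiscriminantInt)
    (ℓ : ℕ) [Fact ℓ.Prime] (hm : W.HasMultiplicativeReductionAtPrime ℓ)
    (hd : p ∣ ℓ - 1 ∨ p ∣ ℓ + 1) : ¬ p ∣ padicValInt ℓ W.minimalDiscriminantInt :=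
  hc ℓ hm (natCast_eq_one_or_eq_neg_one_of_dvd (Fact.out : ℓ.Prime).one_lt.le hd)

/-- **Lemma 20 (second property) ⟹ W. Zhang's hypothesis (3).** Two distinct multiplicative primes
`ℓ₁ ≠ ℓ₂` with `p ∤ ord_{ℓ_i}(Δ_min)` ("at least two prime factors `ℓ ∣∣ N(E)` … such that `E[p]`
is ramified at `ℓ`", BSZ Lemma 20 with Remark 7; `#Ram(ρ̄_{E,p}) ≥ 2` in Zhang's notation) give
Zhang's (3) = printed (d): "if `N` is not squarefree then `Ram ≠ ∅`, and when `#Ram = 1` the number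
of primes `ℓ ∣∣ N` is even" — the parity clause being vacuous (`#Ram ≠ 1`). The semistability
premise is not used. [cite: BhargavaSkinnerZhang2014, Lemma 20 (p. 10), Thm. 9 (d) and Rem. 7 (p. 5)]
[cite: WZhang2014, Thm. 1.4 (i) (p. 197), hypothesis (3)] -/
theorem zhang_hyp3_of_two_ramified (W : WeierstrassCurve ℚ) [W.IsElliptic] [W.IsGloballyMinimal]
    (p : ℕ) [Fact p.Prime]
    (hram₂ : ∃ ℓ₁ ℓ₂ : ℕ, ∃ _ : Fact ℓ₁.Prime, ∃ _ : Fact ℓ₂.Prime, ℓ₁ ≠ ℓ₂ ∧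
      W.HasMultiplicativeReductionAtPrime ℓ₁ ∧ W.HasMultiplicativeReductionAtPrime ℓ₂ ∧
      ¬ p ∣ padicValInt ℓ₁ W.minimalDiscriminantInt ∧ ¬ p ∣ padicValInt ℓ₂ W.minimalDiscriminantInt) :
    ¬ W.IsSemistable ℤ →
      (∃ ℓ : ℕ, ∃ _ : Fact ℓ.Prime, W.HasMultiplicativeReductionAtPrime ℓ ∧
          ¬ p ∣ padicValInt ℓ W.minimalDiscriminantInt) ∧
        (Set.ncard {ℓ : ℕ | ∃ _ : Fact ℓ.Prime, W.HasMultiplicativeReductionAtPrime ℓ ∧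
            ¬ p ∣ padicValInt ℓ W.minimalDiscriminantInt} = 1 →
          Even (Set.ncard {ℓ : ℕ | ∃ _ : Fact ℓ.Prime, W.HasMultiplicativeReductionAtPrime ℓ})) := by
  obtain ⟨ℓ₁, ℓ₂, i₁, i₂, hne, hm₁, hm₂, hr₁, hr₂⟩ := hram₂
  intro _
  refine ⟨⟨ℓ₁, i₁, hm₁, hr₁⟩, fun h1 ↦ absurd h1 ?_⟩
  exact setOf_ncard_ne_one
    (P := fun ℓ : ℕ ↦ ∃ _ : Fact ℓ.Prime, W.HasMultiplicativeReductionAtPrime ℓ ∧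
      ¬ p ∣ padicValInt ℓ W.minimalDiscriminantInt) ⟨i₁, hm₁, hr₁⟩ ⟨i₂, hm₂, hr₂⟩ hne

end ZhangHypotheses

/-! ### Theorem 9 on both legs of (a), `p ≥ 5` -/

section BothLegs

/-- **Bhargava–Skinner–Zhang Thm 9, BOTH LEGS of (a), at `p ≥ 5` — the multiplicative leg
CONDITIONAL on the unrefereed claim `hSZ` (OPEN, labelled).** Let `E/ℚ` have globally minimal model
`W` and let `p ≥ 5` be a prime at which `W` has good ORDINARY reduction (`p ∤ a_p`) OR
multiplicative reduction (printed (a)); suppose `ρ̄_{E,p}` is surjective (printed (b) in W. Zhang's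
form (1)), `p ∤ ord_ℓ(Δ_min)` at every multiplicative `ℓ ≡ ±1 (mod p)` (printed (c), Remark 7),
there are two multiplicative primes `ℓ₁ ≠ ℓ₂`, both `≠ p`, with `p ∤ ord_{ℓ_i}(Δ_min)` (Lemma 20's
second 100 % condition, implying printed (d)), and — if `W` is multiplicative at `p` —
`p ∤ ord_p(Δ_min)` and, if split, `ord_p 𝓛_p(E) = 1` for every Tate parameter datum (printed (e));
and `#Sel^(p)(E/ℚ) = p` (printed (f)). Then `rank E(ℚ) = 1` and `ord_{s=1} L(E,s) = 1` — granted,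
on the good-ordinary leg, W. Zhang 2014 Thm. 1.4 (i) `hZ` (PUB; sibling
`bsz_thm9_goodOrdinary_of_zhang`, Zhang's (2) / (3) by `zhang_hyp2_of_congr` /
`zhang_hyp3_of_two_ramified`) and, on the multiplicative leg, Skinner–Zhang Thm. 1.1 `hSZ` (OPEN;
sibling `bsz_thm9_multiplicative_of_skinnerZhang`, Skinner–Zhang's (a)–(e) by
`skinnerZhang_hypotheses_of_exists_ramified_ne`, (b)'s `log_p`-clause from (e) by Lemma 18
`valuation_lInvariant_eq_valuation_padicLog_of_not_dvd`), both below the Cassels–Tate pairing `hCT`.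
A result using this theorem is conditional on an unrefereed claim («literal-PRE») whenever `W` is
multiplicative at `p`. [cite: BhargavaSkinnerZhang2014, Thm. 9 and its proof (§2.2, p. 5), Lemma 18 (pp. 8–9), Lemma 20 (p. 10)]
[cite: WZhang2014, Thm. 1.4 (i) (p. 197)] [claim: SkinnerZhang2014, status: under-review] -/
theorem bsz_thm9_of_zhang_of_skinnerZhang
    (hZ : WZhang2014.thm14i_rank_one_of_selmerCorank_eq_one)
    (hSZ : SkinnerZhang2014.thm1_1_rank_one_of_selmerCorank_eq_one_OPEN)
    (hCT : exists_casselsTate_pairing (K := ℚ))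
    (W : WeierstrassCurve ℚ) [W.IsElliptic] [W.IsGloballyMinimal] (p : ℕ) [Fact p.Prime]
    (hp : 5 ≤ p)
    (hred : (W.HasGoodReductionAtPrime p ∧ ¬ (p : ℤ) ∣ W.frobeniusTrace p) ∨
      W.HasMultiplicativeReductionAtPrime p)
    (hsurj : W.HasSurjectiveModNGaloisRep p)
    (hc : ∀ (ℓ : ℕ) [Fact ℓ.Prime], W.HasMultiplicativeReductionAtPrime ℓ →
      ((ℓ : ZMod p) = 1 ∨ (ℓ : ZMod p) = -1) → ¬ p ∣ padicValInt ℓ W.minimalDiscriminantInt)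
    (hram₂ : ∃ ℓ₁ ℓ₂ : ℕ, ∃ _ : Fact ℓ₁.Prime, ∃ _ : Fact ℓ₂.Prime, ℓ₁ ≠ ℓ₂ ∧ ℓ₁ ≠ p ∧ ℓ₂ ≠ p ∧
      W.HasMultiplicativeReductionAtPrime ℓ₁ ∧ W.HasMultiplicativeReductionAtPrime ℓ₂ ∧
      ¬ p ∣ padicValInt ℓ₁ W.minimalDiscriminantInt ∧ ¬ p ∣ padicValInt ℓ₂ W.minimalDiscriminantInt)
    (hfin : W.HasMultiplicativeReductionAtPrime p → ¬ p ∣ padicValInt p W.minimalDiscriminantInt)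
    (hL : W.HasSplitMultiplicativeReductionAtPrime p →
      ∀ D : TateParameterData W p, (LInvariant D).valuation = 1)
    (hSel : Nat.card (W.selmerGroup p) = p) :
    W.mordellWeilRank = 1 ∧ W.analyticRank = 1 := by
  haveI : NeZero ((p : ℕ) : ℚ) := ⟨Nat.cast_ne_zero.mpr (Fact.out : p.Prime).ne_zero⟩
  obtain ⟨ℓ₁, ℓ₂, i₁, i₂, hne, hne₁, -, hm₁, hm₂, hr₁, hr₂⟩ := hram₂
  rcases hred with ⟨hgood, hord⟩ | hmult
  · -- "[Z] (for the case of good reduction)"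
    exact bsz_thm9_goodOrdinary_of_zhang hZ hCT W p hp hgood hord hsurj
      (fun ℓ _ hm hd ↦ zhang_hyp2_of_congr W p hc ℓ hm hd)
      (zhang_hyp3_of_two_ramified W p ⟨ℓ₁, ℓ₂, i₁, i₂, hne, hm₁, hm₂, hr₁, hr₂⟩) hSel
  · -- "[SZ] (for the case of multiplicative reduction)"
    have hfinp : ¬ p ∣ padicValInt p W.minimalDiscriminantInt := hfin hmult
    have hlog : W.HasSplitMultiplicativeReductionAtPrime p →
        ∀ D : TateParameterData W p, (padicLog p D.q).valuation = 1 := by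
      intro hs D
      rw [← valuation_lInvariant_eq_valuation_padicLog_of_not_dvd W p D hfinp]
      exact hL hs D
    have hirr : W.HasIrreducibleModPGaloisRep p :=
      hasIrreducibleModPGaloisRep_of_hasSurjectiveModNGaloisRep W p hsurj
    have hH : SkinnerZhang2014.Hypotheses W p :=
      skinnerZhang_hypotheses_of_exists_ramified_ne W p hmult hfinp hlog hirr (fun ℓ _ ↦ hc ℓ)
        ⟨ℓ₁, i₁, hne₁, hm₁, hr₁⟩
    exact bsz_thm9_multiplicative_of_skinnerZhang hSZ hCT W p hp hH hSel

/-- **Thm 9, both legs of (a), `p ≥ 5`, for an ARBITRARY model** `E/ℚ` with global minimal model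
`W`, `C • W = E` — the multiplicative leg CONDITIONAL on `hSZ` (OPEN, labelled): (a), (c), Lemma
20's two primes and (e) are read on `W` (they mention `a_p`, `Δ_min`, the Tate period), (b) =
`ρ̄_{E,p}` surjective and (f) `#Sel^(p)(E/ℚ) = p` on `E` (isomorphism invariants: tree
`hasSurjectiveModNGaloisRep_smul_iff`); conclusion for `E` (siblings
`bsz_thm9_goodOrdinary_of_zhang_of_smul_eq`, `bsz_thm9_multiplicative_of_skinnerZhang_of_smul_eq`).
[cite: BhargavaSkinnerZhang2014, Thm. 9 (§2.2, p. 5), Lemma 18 (pp. 8–9), Lemma 20 (p. 10)]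
[cite: WZhang2014, Thm. 1.4 (i) (p. 197)] [cite: SilvermanAEC2009, X.§4 and VIII.8 Cor. 8.3]
[claim: SkinnerZhang2014, status: under-review] -/
theorem bsz_thm9_of_zhang_of_skinnerZhang_of_smul_eq
    (hZ : WZhang2014.thm14i_rank_one_of_selmerCorank_eq_one)
    (hSZ : SkinnerZhang2014.thm1_1_rank_one_of_selmerCorank_eq_one_OPEN)
    (hCT : exists_casselsTate_pairing (K := ℚ))
    {W : WeierstrassCurve ℚ} [W.IsElliptic] [W.IsGloballyMinimal] {C : VariableChange ℚ}
    {E : WeierstrassCurve ℚ} [E.IsElliptic] (hCW : C • W = E) (p : ℕ) [Fact p.Prime]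
    (hp : 5 ≤ p)
    (hred : (W.HasGoodReductionAtPrime p ∧ ¬ (p : ℤ) ∣ W.frobeniusTrace p) ∨
      W.HasMultiplicativeReductionAtPrime p)
    (hsurj : E.HasSurjectiveModNGaloisRep p)
    (hc : ∀ (ℓ : ℕ) [Fact ℓ.Prime], W.HasMultiplicativeReductionAtPrime ℓ →
      ((ℓ : ZMod p) = 1 ∨ (ℓ : ZMod p) = -1) → ¬ p ∣ padicValInt ℓ W.minimalDiscriminantInt)
    (hram₂ : ∃ ℓ₁ ℓ₂ : ℕ, ∃ _ : Fact ℓ₁.Prime, ∃ _ : Fact ℓ₂.Prime, ℓ₁ ≠ ℓ₂ ∧ ℓ₁ ≠ p ∧ ℓ₂ ≠ p ∧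
      W.HasMultiplicativeReductionAtPrime ℓ₁ ∧ W.HasMultiplicativeReductionAtPrime ℓ₂ ∧
      ¬ p ∣ padicValInt ℓ₁ W.minimalDiscriminantInt ∧ ¬ p ∣ padicValInt ℓ₂ W.minimalDiscriminantInt)
    (hfin : W.HasMultiplicativeReductionAtPrime p → ¬ p ∣ padicValInt p W.minimalDiscriminantInt)
    (hL : W.HasSplitMultiplicativeReductionAtPrime p →
      ∀ D : TateParameterData W p, (LInvariant D).valuation = 1)
    (hSel : Nat.card (E.selmerGroup p) = p) :
    E.mordellWeilRank = 1 ∧ E.analyticRank = 1 := by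
  haveI : NeZero ((p : ℕ) : ℚ) := ⟨Nat.cast_ne_zero.mpr (Fact.out : p.Prime).ne_zero⟩
  obtain ⟨ℓ₁, ℓ₂, i₁, i₂, hne, hne₁, -, hm₁, hm₂, hr₁, hr₂⟩ := hram₂
  rcases hred with ⟨hgood, hord⟩ | hmult
  · -- "[Z] (for the case of good reduction)"
    exact bsz_thm9_goodOrdinary_of_zhang_of_smul_eq hZ hCT hCW p hp hgood hord hsurj
      (fun ℓ _ hm hd ↦ zhang_hyp2_of_congr W p hc ℓ hm hd)
      (zhang_hyp3_of_two_ramified W p ⟨ℓ₁, ℓ₂, i₁, i₂, hne, hm₁, hm₂, hr₁, hr₂⟩) hSel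
  · -- "[SZ] (for the case of multiplicative reduction)"
    have hWE : C⁻¹ • E = W := by rw [← hCW, smul_smul, inv_mul_cancel, one_smul]
    have hsurjW : W.HasSurjectiveModNGaloisRep p := by
      rw [← hWE]; exact (hasSurjectiveModNGaloisRep_smul_iff E C⁻¹ p).2 hsurj
    have hfinp : ¬ p ∣ padicValInt p W.minimalDiscriminantInt := hfin hmult
    have hlog : W.HasSplitMultiplicativeReductionAtPrime p →
        ∀ D : TateParameterData W p, (padicLog p D.q).valuation = 1 := by
      intro hs D
      rw [← valuation_lInvariant_eq_valuation_padicLog_of_not_dvd W p D hfinp]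
      exact hL hs D
    have hirr : W.HasIrreducibleModPGaloisRep p :=
      hasIrreducibleModPGaloisRep_of_hasSurjectiveModNGaloisRep W p hsurjW
    have hH : SkinnerZhang2014.Hypotheses W p :=
      skinnerZhang_hypotheses_of_exists_ramified_ne W p hmult hfinp hlog hirr (fun ℓ _ ↦ hc ℓ)
        ⟨ℓ₁, i₁, hne₁, hm₁, hr₁⟩
    exact bsz_thm9_multiplicative_of_skinnerZhang_of_smul_eq hSZ hCT hCW p hp hH hSel

end BothLegs

/-! ### The binder `h9` on all of `T ∩ S₁ ∩ W` in the `(A, B)` currency -/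

section HeightFamily

/-- **`S₁(5)`'s bullet read on the minimal model.** For `(A, B)` in the height family with global
minimal model `W` of `E_{A,B}` (`C • W = E_{A,B}`): if `5 ∤ ord_ℓ(4A³ + 27B²)` for all primes
`ℓ ≡ ±1 (mod 5)` with `ord_ℓ(4A³ + 27B²) > 0` (BSZ §3.1, the bullet defining `S₁(5) ⊆ S₁'(5)`, with
`Δ(E_{A,B}) = -16(4A³ + 27B²)`), then every multiplicative prime `ℓ ≡ ±1 (mod 5)` of `W` has
`5 ∤ ord_ℓ(Δ_min)`: such an `ℓ` is `≥ 5` (`2, 3 ≢ ±1`), so `E_{A,B}` is minimal at `ℓ` (Remark 7;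
tree `padicValInt_minimalDiscriminantInt_smul_shortWeierstrass`) and `ℓ ∣ 4A³ + 27B²` (tree
`hasMultiplicativeReductionAtPrime_shortWeierstrass_iff_of_isInHeightFamily`).
[cite: BhargavaSkinnerZhang2014, §3.1 (p. 8), Rem. 7 (p. 5)] -/
theorem not_dvd_padicValInt_minimalDiscriminantInt_of_congr_five [Fact (Nat.Prime 5)]
    {W : WeierstrassCurve ℚ} [W.IsElliptic] [W.IsGloballyMinimal] {C : VariableChange ℚ}
    {AB : ℤ × ℤ} (hfam : IsInHeightFamily AB) (hCW : C • W = shortWeierstrass AB)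
    (hc : ∀ (ℓ : ℕ) [Fact ℓ.Prime], ((ℓ : ZMod 5) = 1 ∨ (ℓ : ZMod 5) = -1) →
      0 < padicValInt ℓ (4 * AB.1 ^ 3 + 27 * AB.2 ^ 2) →
        ¬ 5 ∣ padicValInt ℓ (4 * AB.1 ^ 3 + 27 * AB.2 ^ 2))
    (ℓ : ℕ) [iℓ : Fact ℓ.Prime] (hmℓ : W.HasMultiplicativeReductionAtPrime ℓ)
    (hℓ : (ℓ : ZMod 5) = 1 ∨ (ℓ : ZMod 5) = -1) :
    ¬ 5 ∣ padicValInt ℓ W.minimalDiscriminantInt := by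
  haveI := isElliptic_shortWeierstrass hfam
  have hWC : C⁻¹ • shortWeierstrass AB = W := by rw [← hCW, smul_smul, inv_mul_cancel, one_smul]
  have hℓ5 : 5 ≤ ℓ := by
    have hprime := iℓ.out
    have h2 := hprime.two_le
    have hc4 : ¬ Nat.Prime 4 := by norm_num
    rcases lt_or_ge ℓ 5 with hlt | hge
    · exfalso
      -- `2, 3 ≢ ±1 (mod 5)` by evaluation in `ZMod 5`; `4` is not prime
      interval_cases ℓ
      · exact absurd hℓ (of_decide_eq_false rfl)
      · exact absurd hℓ (of_decide_eq_false rfl)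
      · exact hc4 hprime
    · exact hge
  have hmℓE : (shortWeierstrass AB).HasMultiplicativeReductionAtPrime ℓ := by
    rw [← hCW]; exact (hasMultiplicativeReductionAtPrime_smul_iff W C ℓ).2 hmℓ
  have hdvd : (ℓ : ℤ) ∣ 4 * AB.1 ^ 3 + 27 * AB.2 ^ 2 :=
    ((hasMultiplicativeReductionAtPrime_shortWeierstrass_iff_of_isInHeightFamily ℓ hfam hℓ5).1
      hmℓE).1
  have hpos : 0 < padicValInt ℓ (4 * AB.1 ^ 3 + 27 * AB.2 ^ 2) := by
    have h := (padicValInt_dvd_iff (p := ℓ) 1 (4 * AB.1 ^ 3 + 27 * AB.2 ^ 2)).1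
      (by rw [pow_one]; exact hdvd)
    rcases h with h | h
    · exact absurd h hfam.1
    · exact h
  rw [padicValInt_minimalDiscriminantInt_smul_shortWeierstrass hfam W C⁻¹ hWC hℓ5]
  exact hc ℓ hℓ hpos

/-- **The binder `h9` of `bsz_rankLeOne_cRank_of_pieces` on ALL of `T ∩ S₁ ∩ W`, the two ramified
primes read on a given global minimal model — the multiplicative-at-`5` half CONDITIONAL on `hSZ`
(OPEN, labelled).** For `(A, B)` in the height family and a global minimal model `W` of `E_{A,B}`
(`C • W = E_{A,B}`), suppose, in the printed currency of BSZ §3.1 (p. 8), Thm 9 and Lemma 20: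
* `5 ∤ A` — `E_{A,B} ∈ S₀(5)`: good ordinary OR multiplicative at `5` (Lemma 17);
* if `5 ∣ 4A³ + 27B²` (multiplicative at `5`): `5 ∤ ord_5(4A³ + 27B²)` (`S₁'(5)`, first bullet =
  Thm 9 (e) "`E[5]` is not finite at `5`", Remark 11), and, if `E_{A,B}` is split multiplicative
  at `5`, `ord_5(𝓛(E_{A,B})) = 1` for (any) Tate parameter datum (`S₁'(5)`, second bullet);
* `5 ∤ ord_ℓ(4A³ + 27B²)` for all primes `ℓ ≡ ±1 (mod 5)` with `ord_ℓ(4A³ + 27B²) > 0` (`S₁(5)`'s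
  bullet = Thm 9 (c) with Remark 7);
* `ρ̄_{E_{A,B},5}` is surjective (W. Zhang's (1); implies Thm 9 (b) = Lemma 20's first property);
* there are two multiplicative primes `ℓ₁ ≠ ℓ₂` of `W`, both `≠ 5`, with `5 ∤ ord_{ℓ_i}(Δ_min)`
  (Lemma 20's second property in Thm 5 (c)'s currency; `ℓ_i ∈ {2, 3}` allowed);
* `#Sel^(5)(E_{A,B}/ℚ) = 5` (Thm 9 (f)).
Then `rank E_{A,B}(ℚ) = 1 ∧ ord_{s=1} L(E_{A,B}, s) = 1` — by cases on `5 ∣ 4A³ + 27B²`: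
multiplicative at `5` ↦ sibling `bsz_h9_multiplicative_five_of_skinnerZhang_of_ram` below `hSZ`
(«literal-PRE»), good ordinary at `5` ↦ sibling `bsz_h9_goodOrdinary_five_of_zhang_of_smul_eq`
below `hZ` (PUB), Zhang's (2) / (3) by `not_dvd_padicValInt_minimalDiscriminantInt_of_congr_five` /
`zhang_hyp3_of_two_ramified`; both below `hCT`.
[cite: BhargavaSkinnerZhang2014, Thm. 9 (§2.2, p. 5), Thm. 5 (c), Rem. 7, Rem. 11 (§2.1, p. 5), §3.1 (p. 8), Lemma 20 (p. 10)]
[cite: WZhang2014, Thm. 1.4 (i) (p. 197)] [claim: SkinnerZhang2014, status: under-review] -/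
theorem bsz_h9_five_of_zhang_of_skinnerZhang_of_ram
    (hZ : WZhang2014.thm14i_rank_one_of_selmerCorank_eq_one)
    (hSZ : SkinnerZhang2014.thm1_1_rank_one_of_selmerCorank_eq_one_OPEN)
    (hCT : exists_casselsTate_pairing (K := ℚ)) [Fact (Nat.Prime 5)]
    {W : WeierstrassCurve ℚ} [W.IsElliptic] [W.IsGloballyMinimal] {C : VariableChange ℚ}
    {AB : ℤ × ℤ} (hfam : IsInHeightFamily AB) (hCW : C • W = shortWeierstrass AB)
    (hA : ¬ (5 : ℤ) ∣ AB.1)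
    (hfin : (5 : ℤ) ∣ 4 * AB.1 ^ 3 + 27 * AB.2 ^ 2 →
      ¬ 5 ∣ padicValInt 5 (4 * AB.1 ^ 3 + 27 * AB.2 ^ 2))
    (hL : ∀ [(shortWeierstrass AB).IsElliptic],
      (shortWeierstrass AB).HasSplitMultiplicativeReductionAtPrime 5 →
        ∀ D : TateParameterData (shortWeierstrass AB) 5, (LInvariant D).valuation = 1)
    (hc : ∀ (ℓ : ℕ) [Fact ℓ.Prime], ((ℓ : ZMod 5) = 1 ∨ (ℓ : ZMod 5) = -1) →
      0 < padicValInt ℓ (4 * AB.1 ^ 3 + 27 * AB.2 ^ 2) →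
        ¬ 5 ∣ padicValInt ℓ (4 * AB.1 ^ 3 + 27 * AB.2 ^ 2))
    (hsurj : (shortWeierstrass AB).HasSurjectiveModNGaloisRep 5)
    (hram₂ : ∃ ℓ₁ ℓ₂ : ℕ, ∃ _ : Fact ℓ₁.Prime, ∃ _ : Fact ℓ₂.Prime, ℓ₁ ≠ ℓ₂ ∧ ℓ₁ ≠ 5 ∧ ℓ₂ ≠ 5 ∧
      W.HasMultiplicativeReductionAtPrime ℓ₁ ∧ W.HasMultiplicativeReductionAtPrime ℓ₂ ∧
      ¬ 5 ∣ padicValInt ℓ₁ W.minimalDiscriminantInt ∧ ¬ 5 ∣ padicValInt ℓ₂ W.minimalDiscriminantInt)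
    (hSel : Nat.card ((shortWeierstrass AB).selmerGroup 5) = 5) :
    (shortWeierstrass AB).mordellWeilRank = 1 ∧ (shortWeierstrass AB).analyticRank = 1 := by
  haveI := isElliptic_shortWeierstrass hfam
  haveI : NeZero ((5 : ℕ) : ℚ) := ⟨by norm_num⟩
  obtain ⟨ℓ₁, ℓ₂, i₁, i₂, hne, hne₁, -, hm₁, hm₂, hr₁, hr₂⟩ := hram₂
  by_cases hD : (5 : ℤ) ∣ 4 * AB.1 ^ 3 + 27 * AB.2 ^ 2
  · -- multiplicative at `5`: "[SZ]"
    have hirr : (shortWeierstrass AB).HasIrreducibleModPGaloisRep 5 :=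
      hasIrreducibleModPGaloisRep_of_hasSurjectiveModNGaloisRep (shortWeierstrass AB) 5
        (by exact_mod_cast hsurj)
    exact bsz_h9_multiplicative_five_of_skinnerZhang_of_ram hSZ hCT hfam hCW hA hD (hfin hD) hL hirr
      hc ⟨ℓ₁, i₁, hne₁, hm₁, hr₁⟩ hSel
  · -- good ordinary at `5`: "[Z]"
    exact bsz_h9_goodOrdinary_five_of_zhang_of_smul_eq hZ hCT hfam hCW hA hD hsurj
      (fun ℓ _ hm hd ↦ not_dvd_padicValInt_minimalDiscriminantInt_of_congr_five hfam hCW hc ℓ hm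
        (natCast_eq_one_or_eq_neg_one_of_dvd (Fact.out : ℓ.Prime).one_lt.le hd))
      (zhang_hyp3_of_two_ramified W 5 ⟨ℓ₁, ℓ₂, i₁, i₂, hne, hm₁, hm₂, hr₁, hr₂⟩) hSel

/-- **The binder `h9` of `bsz_rankLeOne_cRank_of_pieces` on ALL of `T ∩ S₁ ∩ W`, ENTIRELY IN THE
`(A, B)` CURRENCY of the height family — the multiplicative-at-`5` half CONDITIONAL on `hSZ` (OPEN,
labelled).** As `bsz_h9_five_of_zhang_of_skinnerZhang_of_ram`, with Lemma 20's second property in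
the form its proof supplies (p. 10: "two primes `5 ≤ ℓ₁, ℓ₂ ≤ L`", `ℓ ≠ p`) and Remark 7 reads it
("for `ℓ ≥ 5` … `E_{A,B}` is minimal at `ℓ`, and so if `ℓ ∣∣ N` then `E_{A,B}[p]` is ramified at
`ℓ` if and only if `p ∤ ord_ℓ(Δ(E_{A,B}))`"): two primes `ℓ₁ ≠ ℓ₂`, both `> 5`, of multiplicative
reduction of `E_{A,B}` with `5 ∤ ord_{ℓ_i}(4A³ + 27B²)`. A global minimal model `W`
(`C • W = E_{A,B}`) is still named, as both legs read Zhang's / Skinner–Zhang's hypotheses on it; the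
two primes are moved to `W` by `ord_ℓ(Δ_min) = ord_ℓ(4A³ + 27B²)` for `ℓ ≥ 5` (tree
`padicValInt_minimalDiscriminantInt_smul_shortWeierstrass`).
[cite: BhargavaSkinnerZhang2014, Thm. 9 (§2.2, p. 5), Rem. 7, Rem. 11 (§2.1, p. 5), §3.1 (p. 8), Lemma 20 and its proof (p. 10)]
[cite: WZhang2014, Thm. 1.4 (i) (p. 197)] [claim: SkinnerZhang2014, status: under-review] -/
theorem bsz_h9_five_of_zhang_of_skinnerZhang
    (hZ : WZhang2014.thm14i_rank_one_of_selmerCorank_eq_one)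
    (hSZ : SkinnerZhang2014.thm1_1_rank_one_of_selmerCorank_eq_one_OPEN)
    (hCT : exists_casselsTate_pairing (K := ℚ)) [Fact (Nat.Prime 5)]
    {W : WeierstrassCurve ℚ} [W.IsElliptic] [W.IsGloballyMinimal] {C : VariableChange ℚ}
    {AB : ℤ × ℤ} (hfam : IsInHeightFamily AB) (hCW : C • W = shortWeierstrass AB)
    (hA : ¬ (5 : ℤ) ∣ AB.1)
    (hfin : (5 : ℤ) ∣ 4 * AB.1 ^ 3 + 27 * AB.2 ^ 2 →
      ¬ 5 ∣ padicValInt 5 (4 * AB.1 ^ 3 + 27 * AB.2 ^ 2))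
    (hL : ∀ [(shortWeierstrass AB).IsElliptic],
      (shortWeierstrass AB).HasSplitMultiplicativeReductionAtPrime 5 →
        ∀ D : TateParameterData (shortWeierstrass AB) 5, (LInvariant D).valuation = 1)
    (hc : ∀ (ℓ : ℕ) [Fact ℓ.Prime], ((ℓ : ZMod 5) = 1 ∨ (ℓ : ZMod 5) = -1) →
      0 < padicValInt ℓ (4 * AB.1 ^ 3 + 27 * AB.2 ^ 2) →
        ¬ 5 ∣ padicValInt ℓ (4 * AB.1 ^ 3 + 27 * AB.2 ^ 2))
    (hsurj : (shortWeierstrass AB).HasSurjectiveModNGaloisRep 5)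
    (hram₂ : ∃ ℓ₁ ℓ₂ : ℕ, ∃ _ : Fact ℓ₁.Prime, ∃ _ : Fact ℓ₂.Prime, ℓ₁ ≠ ℓ₂ ∧ 5 < ℓ₁ ∧ 5 < ℓ₂ ∧
      (shortWeierstrass AB).HasMultiplicativeReductionAtPrime ℓ₁ ∧
      (shortWeierstrass AB).HasMultiplicativeReductionAtPrime ℓ₂ ∧
      ¬ 5 ∣ padicValInt ℓ₁ (4 * AB.1 ^ 3 + 27 * AB.2 ^ 2) ∧
      ¬ 5 ∣ padicValInt ℓ₂ (4 * AB.1 ^ 3 + 27 * AB.2 ^ 2))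
    (hSel : Nat.card ((shortWeierstrass AB).selmerGroup 5) = 5) :
    (shortWeierstrass AB).mordellWeilRank = 1 ∧ (shortWeierstrass AB).analyticRank = 1 := by
  haveI := isElliptic_shortWeierstrass hfam
  have hWC : C⁻¹ • shortWeierstrass AB = W := by rw [← hCW, smul_smul, inv_mul_cancel, one_smul]
  -- the two ramified primes `ℓ > 5` read on the minimal model
  have hmW : ∀ (ℓ : ℕ) [Fact ℓ.Prime], (shortWeierstrass AB).HasMultiplicativeReductionAtPrime ℓ →
      W.HasMultiplicativeReductionAtPrime ℓ := by
    intro ℓ _ hm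
    rw [← hasMultiplicativeReductionAtPrime_smul_iff W C ℓ, hCW]; exact hm
  have hrW : ∀ (ℓ : ℕ) [Fact ℓ.Prime], 5 < ℓ → ¬ 5 ∣ padicValInt ℓ (4 * AB.1 ^ 3 + 27 * AB.2 ^ 2) →
      ¬ 5 ∣ padicValInt ℓ W.minimalDiscriminantInt := by
    intro ℓ _ hℓ hr
    rw [padicValInt_minimalDiscriminantInt_smul_shortWeierstrass hfam W C⁻¹ hWC hℓ.le]; exact hr
  obtain ⟨ℓ₁, ℓ₂, i₁, i₂, hne, h₁, h₂, hm₁, hm₂, hr₁, hr₂⟩ := hram₂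
  exact bsz_h9_five_of_zhang_of_skinnerZhang_of_ram hZ hSZ hCT hfam hCW hA hfin hL hc hsurj
    ⟨ℓ₁, ℓ₂, i₁, i₂, hne, by omega, by omega, hmW ℓ₁ hm₁, hmW ℓ₂ hm₂, hrW ℓ₁ h₁ hr₁, hrW ℓ₂ h₂ hr₂⟩
    hSel

end HeightFamily

end Literature.NumberTheory.EllipticCurves

end
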